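import Literature.Geometry.Lorentzian.QuantitativeAlexandrovZeeman

/-!
# Route StarvedNecks — crux `GapDecaySuffices` (stmt-FinalStateConjecture-18060), line `Sketch`:
# brick `stub_quantAlexandrovZeeman` (quantitative Alexandrov–Zeeman on a ball)

The registered brick `stub_quantAlexandrovZeeman : QuantAlexandrovZeeman` of the lead's skeleton
`Cruxes/GapDecaySuffices/Lines/Sketch.lean` (frame-free zeroth-order rigidity, Minkowskian core; consumed by
the location stub S4 and by the switch-off strategy S3 §7), discharged by the Literature theorem
`Literature.Geometry.Lorentzian.MinkowskiSimplex.quantAlexandrovZeeman_ball`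
(`Literature/Geometry/Lorentzian/QuantitativeAlexandrovZeeman.lean`, built on `MinkowskiSimplexFit.lean`).
The statement is inlined as a `let` so that the header ends in the registered text.
-/

noncomputable section

open Literature.Geometry.Lorentzian

namespace Summit.FinalStateConjecture.FinalStateConjecture.Theorems.GapDecaySuffices.QAZ

set_option linter.dupNamespace false

/-- **Registered brick `stub_quantAlexandrovZeeman`** (statement of the skeleton's `QuantAlexandrovZeeman`
inlined): there are universal `C, δ* > 0` such that a map `k : E4 → E4` preserving the Minkowski interval of
every steep pair of points of `B(x₀, 20ℓ)` up to relative error `δ ≤ δ*` is, on `B(x₀, ℓ)`, `Cδℓ`-close in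
the domain frame (`k y = A (y + e) + c`, `‖e‖ ≤ Cδℓ`) to an affine map whose linear part `A` is
`Cδ`-approximately Lorentz.  Alexandrov 1950 / Zeeman 1964 (exact case); quantitative version
`MinkowskiSimplex.quantAlexandrovZeeman_ball`. [folklore] -/
theorem stub_quantAlexandrovZeeman :
    let QuantAlexandrovZeeman : Prop :=
      ∃ C δs : ℝ, 0 < C ∧ 0 < δs ∧
        ∀ (δ ℓ : ℝ) (x₀ : E4) (k : E4 → E4), 0 < δ → δ ≤ δs → 0 < ℓ →
          (∀ y ∈ Metric.ball x₀ (20 * ℓ), ∀ z ∈ Metric.ball x₀ (20 * ℓ),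
            Minkowski.bilin (z - y) (z - y) ≤ -(1 / 4) * ‖z - y‖ ^ 2 →
            |Minkowski.bilin (k z - k y) (k z - k y) - Minkowski.bilin (z - y) (z - y)| ≤
              δ * |Minkowski.bilin (z - y) (z - y)|) →
          ∃ (A : E4 →L[ℝ] E4) (c : E4),
            (∀ v w : E4, |Minkowski.bilin (A v) (A w) - Minkowski.bilin v w| ≤ C * δ * ‖v‖ * ‖w‖) ∧
            ∀ y ∈ Metric.ball x₀ ℓ, ∃ e : E4, ‖e‖ ≤ C * δ * ℓ ∧ k y = A (y + e) + c
    QuantAlexandrovZeeman :=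
  MinkowskiSimplex.quantAlexandrovZeeman_ball

end Summit.FinalStateConjecture.FinalStateConjecture.Theorems.GapDecaySuffices.QAZ

end
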